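import Literature.NumberTheory.EllipticCurves.KatoFineSelmerDualProofs
import HarnessLib

/-!
# Route `KatoDescentTamePotSupersingular` / `KatoDescentPotSupersingular` (cell `bsd-potss`): the PER-ROW
# equivalence «∃-form ⟺ canonical ∀-form» of Coates–Sujatha's statement (A), ROUTE-FREE (imports NO
# `Theses.*` file) — so that a ∀-canonical restatement of the Conj-A cruxes 19413 / 19386 (planner's
# option, TARGET R100) can be converted row by row inside `closes` (a `--supports … --as helper` file;
# seat `bsd-potss-k8t-c4` g3; nothing booked, BSD not proved by any of this)

WHY THIS FILE EXISTS. p428519 (`…TameFineSelmerOfCanonicalDual`, g2 of this seat) proved the datum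
independence `FineSelmerDualData.finite_restrictScalars_iff` and the iff «item 19413 ⟺ Conj A on the
canonical dual», but concluded the ROUTE DECL, so that file imports the route and `closes` cannot use it
(TARGET R100a). Here the per-row, route-free form: for ONE curve `W`, prime `p` and cyclotomic-or-not
`ℤ_p`-extension `κ`, **`(∃ γ D, D.X f.g./ℤ_p) ⟺ (∀ γ hγ, (W.fineSelmerDualData κ hγ).X f.g./ℤ_p)`**
(`exists_fineSelmerDualData_finite_iff_forall_canonical`; the datum-independence lemma enters as a
PRIVATE verbatim copy of p428519 §1 — the gate's dedup rule forbids public restatement). With it the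
route-free node theorems of this seat (`TameUpperHeegnerRoad.upperNonsurjTower_…`, p437915;
`WildUpperHeegnerRoad.wildUpperNonsurjTower_…`, p438322), which take the ∃-form on the ♯ rows, are fed
from a ∀-canonical item by `fun W _ _ p _ … κ hκ ↦ (exists_…_iff_forall_canonical W κ).mpr (hCS∀ W p … κ hκ)`.
Nothing about Conjecture A is asserted; no item is closed.

References: [CoatesSujatha2005] §3, Conjecture A; [GreenbergLNM1716] §1; [Lim2017FineSelmer] §3.
-/

set_option autoImplicit false
-- the Theorems directory repeats the summit name (sibling precedent `KatoDescentPotSupersingularAssembly.lean`)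
set_option linter.dupNamespace false

noncomputable section

open scoped Classical

namespace Summit.BirchSwinnertonDyer.BirchSwinnertonDyer.Theorems.FineSelmerCanonicalNode

open WeierstrassCurve Literature.NumberTheory.EllipticCurves

variable {K : Type} [Field K] [NumberField K] {W : WeierstrassCurve K} {p : ℕ} [Fact p.Prime]
  {κ : ZpExtension K p}

/-- **Datum independence of «`X₀` finitely generated over `ℤ_p`».** For ANY two dual fine Selmer data
`D₁ : W.FineSelmerDualData κ γ₁`, `D₂ : W.FineSelmerDualData κ γ₂` (any `γ₁`, `γ₂`): `D₁.X` is a finitely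
generated `ℤ_p`-module iff `D₂.X` is. Indeed `D₂.toDual⁻¹ ∘ D₁.toDual : D₁.X ≃ D₂.X` (both `toDual` are
bijections onto `Hom(Sel₀(K_∞, E[p^∞]), ℚ/ℤ)`) is `ℤ_p`-LINEAR: on a class `s` with `p^k s = 0` (every class
is `p`-power torsion, `exists_pow_smul_subgroupH1_ker_eq_zero`) both `ℤ_p`-actions read `c ↦ (c mod p^k)`
by `toDual_C_smul`. In particular the item's `∃ γ D` clause carries no information beyond the canonical
object `W.fineSelmerDualData κ hγ` (file `KatoFineSelmerDualProofs`).
[cite: CoatesSujatha2005, §3 (the dual fine Selmer group as a Λ(Γ)-module)] [cite: GreenbergLNM1716, §1 (after Conj. 1.3)] -/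
private theorem finite_restrictScalars_iff' {γ₁ γ₂ : Field.absoluteGaloisGroup K}
    (D₁ : W.FineSelmerDualData κ γ₁) (D₂ : W.FineSelmerDualData κ γ₂) :
    Module.Finite ℤ_[p] (RestrictScalars ℤ_[p] (IwasawaAlgebra p) D₁.X) ↔
      Module.Finite ℤ_[p] (RestrictScalars ℤ_[p] (IwasawaAlgebra p) D₂.X) := by
  -- the additive equivalence `D₂.toDual⁻¹ ∘ D₁.toDual`
  let e₀ : D₁.X ≃+ D₂.X :=
    (AddEquiv.ofBijective (D₁.toDual : D₁.X →+ (W.fineSelmerInfty κ →+ AddCircle (1 : ℚ))) D₁.bijective).trans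
      (AddEquiv.ofBijective (D₂.toDual : D₂.X →+ (W.fineSelmerInfty κ →+ AddCircle (1 : ℚ)))
        D₂.bijective).symm
  have he₀ : ∀ x : D₁.X, D₂.toDual (e₀ x) = D₁.toDual x := fun x ↦ by
    show (AddEquiv.ofBijective (D₂.toDual : D₂.X →+ (W.fineSelmerInfty κ →+ AddCircle (1 : ℚ)))
        D₂.bijective) (e₀ x) = _
    exact AddEquiv.apply_symm_apply _ _
  -- `ℤ_p`-linearity on the nose: both actions are pinned on `p^k`-torsion classes
  have hsmul : ∀ (c : ℤ_[p]) (x : D₁.X),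
      e₀ ((PowerSeries.C c : IwasawaAlgebra p) • x) = (PowerSeries.C c : IwasawaAlgebra p) • e₀ x :=
    fun c x ↦ by
    apply D₂.bijective.1
    rw [he₀]
    ext s
    obtain ⟨k, hk⟩ : ∃ k : ℕ, p ^ k • s = 0 := by
      obtain ⟨k, hk⟩ := W.exists_pow_smul_subgroupH1_ker_eq_zero κ (s : W.subgroupH1 p κ.kerSubgroup)
      exact ⟨k, Subtype.ext (by rw [AddSubgroupClass.coe_nsmul]; exact hk)⟩
    rw [D₁.toDual_C_smul c x s k hk, D₂.toDual_C_smul c (e₀ x) s k hk, he₀]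
  -- as a `ℤ_p`-linear equivalence of the scalar restrictions
  let e : RestrictScalars ℤ_[p] (IwasawaAlgebra p) D₁.X ≃ₗ[ℤ_[p]]
      RestrictScalars ℤ_[p] (IwasawaAlgebra p) D₂.X :=
    AddEquiv.toLinearEquiv
      (e₀ : RestrictScalars ℤ_[p] (IwasawaAlgebra p) D₁.X ≃+ RestrictScalars ℤ_[p] (IwasawaAlgebra p) D₂.X)
      fun c x ↦ by
        rw [RestrictScalars.smul_def, RestrictScalars.smul_def, ← PowerSeries.C_eq_algebraMap]
        exact hsmul c x
  exact ⟨fun _ ↦ Module.Finite.equiv e, fun _ ↦ Module.Finite.equiv e.symm⟩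

/-- **Per row: the ∃-form of (A) ⟺ its canonical ∀-form.** For one curve `W/K`, prime `p` and
`ℤ_p`-extension `κ`: some dual fine Selmer datum has `X` finitely generated over `ℤ_p` iff the CANONICAL
dual `Hom(Sel₀(K_∞, W[p^∞]), ℚ/ℤ)` (`(W.fineSelmerDualData κ hγ).X`, any topological generator `γ`) is —
(→) datum independence (private copy of p428519's `finite_restrictScalars_iff`), (←) the canonical datum
at a topological generator, which exists since `κ` is onto `ℤ_p ∋ 1`. Route-free; no item closed.
[cite: CoatesSujatha2005, §3 and Conjecture A] [cite: GreenbergLNM1716, §1 (after Conj. 1.3)] -/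
theorem exists_fineSelmerDualData_finite_iff_forall_canonical (W : WeierstrassCurve K) (κ : ZpExtension K p) :
    (∃ (γ : Field.absoluteGaloisGroup K) (D : W.FineSelmerDualData κ γ),
        Module.Finite ℤ_[p] (RestrictScalars ℤ_[p] (IwasawaAlgebra p) D.X)) ↔
      ∀ (γ : Field.absoluteGaloisGroup K) (hγ : κ.IsTopGenerator γ),
        Module.Finite ℤ_[p] (RestrictScalars ℤ_[p] (IwasawaAlgebra p) (W.fineSelmerDualData κ hγ).X) := by
  refine ⟨fun ⟨γ', D, hD⟩ γ hγ ↦ (finite_restrictScalars_iff' D (W.fineSelmerDualData κ hγ)).mp hD,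
    fun h ↦ ?_⟩
  obtain ⟨γ, hγ⟩ : ∃ γ : Field.absoluteGaloisGroup K, κ.IsTopGenerator γ :=
    κ.surjective (Multiplicative.ofAdd 1)
  exact ⟨γ, W.fineSelmerDualData κ hγ, h γ hγ⟩

/-- **Per row, pointed version**: the ∃-form from the canonical ∀-form (the direction `closes` needs when a
∀-canonical Conj-A item feeds an ∃-form node theorem). [cite: CoatesSujatha2005, §3 and Conjecture A] -/
theorem exists_fineSelmerDualData_finite_of_forall_canonical (W : WeierstrassCurve K) (κ : ZpExtension K p)
    (h : ∀ (γ : Field.absoluteGaloisGroup K) (hγ : κ.IsTopGenerator γ),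
      Module.Finite ℤ_[p] (RestrictScalars ℤ_[p] (IwasawaAlgebra p) (W.fineSelmerDualData κ hγ).X)) :
    ∃ (γ : Field.absoluteGaloisGroup K) (D : W.FineSelmerDualData κ γ),
      Module.Finite ℤ_[p] (RestrictScalars ℤ_[p] (IwasawaAlgebra p) D.X) :=
  (exists_fineSelmerDualData_finite_iff_forall_canonical W κ).mpr h

end Summit.BirchSwinnertonDyer.BirchSwinnertonDyer.Theorems.FineSelmerCanonicalNode

end
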